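import Summits.ABC.ABC.Theses.FeketeScales
import Summits.ABC.ABC.Theorems.PrimePowerRadical.Negative.Mersenne
import Summits.ABC.ABC.Theorems.PrimePowerRadical.Negative.Orders
import HarnessLib

/-!
# Route FeketeScales — crux `SparseGoodScales` (stmt-ABC-2161): infinitely many primes of ODD
# base-2 Wieferich level (the rung `L = 2` of the windowed floor is a theorem)

Helper file (`--supports stmt-ABC-2161`, lead seat c11), companion of
`FeketeScalesSparseGoodScalesWindowedFloor.lean`.  That file proves that the windowed residue WGS of
the crux (line `Sketch`) forces, for every prime base `q` and every `L`, infinitely many primes that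
are non-Wieferich to base `q` or of Wieferich level `W_p(q) > L` ("rung `L`").  Here we show,
UNCONDITIONALLY, that the rung `L = 2` at `q = 2` holds — so the floor is informative exactly from
`L = 3` on, and a drought statement with a fixed ratio `Λ ≤ 3/2` (reached by that bookkeeping only
for `L < 2Λ ≤ 3`) inherits no open rung: the `∃Λ` residue DA∃ of line `SketchIdeator4` escapes.

* `sparseGoodScales_infinite_odd_wieferichLevel_two` — infinitely many primes `p` have ODD level
  `W_p(2) = v_p(2^{p−1} − 1)`: for a prime `ℓ ≥ 2`, `2^ℓ − 1 ≡ 3 (mod 4)` is not a square, so some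
  prime `p ∣ 2^ℓ − 1` occurs to an odd power; `ord_p(2) = ℓ` gives `p ≡ 1 (mod ℓ)`, `p > ℓ`, and the
  exact valuation `v_p(2^ℓ − 1) = W_p(2) + v_p(ℓ) = W_p(2)` (`padicValNat_family`) makes the level odd.
  (Cf. Rotkiewicz 1965 / Warren–Bray 1967, `sq_dvd_mersenne_iff_isWieferich`: a prime factor of a
  Mersenne number is repeated iff it is Wieferich; the parity remark for a general base `q` needs
  Ljunggren's theorem on `(x^n − 1)/(x − 1) = y²` and lives in `Cruxes/PrimePowerRadical/`.)
* `sparseGoodScales_infinite_nonWieferich_or_two_lt_level` — hence infinitely many primes are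
  non-Wieferich to base `2` (level `1`) or have `2^{p−1} ≡ 1 (mod p³)` (level `≥ 3`).
Neither disjunct alone is known to occur infinitely often.
-/

-- `Summit.<Summit>.<Problem>` is the mandated summit-side namespace (CONVENTIONS §2); for the
-- single-conjunct summit `ABC` the two coincide, so the duplicate `ABC.ABC` is deliberate.
set_option linter.dupNamespace false

noncomputable section

namespace Summit.ABC.ABC.Theorems

open Literature.NumberTheory.DiophantineGeometry UniqueFactorizationMonoid
open Summit.ABC.ABC.Theorems.PrimePowerRadical.Negative

/-- A natural number all of whose prime exponents are even is a square. [folklore] -/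
private theorem sparseGoodScales_isSquare_of_even_factorization {n : ℕ} (hn : n ≠ 0)
    (h : ∀ p ∈ n.primeFactors, Even (n.factorization p)) : IsSquare n := by
  refine ⟨n.factorization.prod fun p k => p ^ (k / 2), ?_⟩
  rw [← Finsupp.prod_mul]
  conv_lhs => rw [← Nat.prod_factorization_pow_eq_self hn]
  apply Finsupp.prod_congr
  intro p hp
  rw [← pow_add]
  congr 1
  obtain ⟨t, ht⟩ := h p (by simpa using hp)
  omega

/-- **Infinitely many primes have ODD Wieferich level to base `2`** (unconditional).  For a prime
`ℓ ≥ 2`, `2^ℓ − 1 ≡ 3 (mod 4)` is not a square, so some prime `p ∣ 2^ℓ − 1` occurs to an odd power;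
for such `p`, `ord_p(2) = ℓ`, so `p ≡ 1 (mod ℓ)` (whence `p > ℓ`) and, by the exact valuation
`v_p(2^ℓ − 1) = W_p(2) + v_p(ℓ) = W_p(2)`, the level `W_p(2)` is odd.  (So among the primes of odd
level, those of level `1` are the non-Wieferich ones and the rest have level `≥ 3`.  The statement
is kept on one line: it is the signature registered on stmt-ABC-2161 for this sub-goal.) [folklore] -/
theorem sparseGoodScales_infinite_odd_wieferichLevel_two : {p : ℕ | p.Prime ∧ Odd (Summit.ABC.ABC.Theorems.PrimePowerRadical.Negative.wieferichLevel 2 p)}.Infinite := by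
  refine Set.infinite_of_forall_exists_gt fun N => ?_
  obtain ⟨ℓ, hℓge, hℓ⟩ := Nat.exists_infinite_primes (N + 3)
  have hℓ1 : 1 ≤ ℓ := hℓ.one_lt.le
  have hpow : 2 ^ ℓ = 4 * 2 ^ (ℓ - 2) := by
    rw [show (4 : ℕ) = 2 ^ 2 by norm_num, ← pow_add]
    congr 1
    omega
  have hpos : 1 ≤ 2 ^ (ℓ - 2) := Nat.one_le_two_pow
  have hM0 : 2 ^ ℓ - 1 ≠ 0 := by omega
  have hM4 : (2 ^ ℓ - 1) % 4 = 3 := by omega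
  -- `2^ℓ − 1` is not a square
  have hnsq : ¬ IsSquare (2 ^ ℓ - 1) := by
    rintro ⟨m, hm⟩
    have hmm : m * m % 4 = 3 := by rw [← hm]; exact hM4
    rw [Nat.mul_mod] at hmm
    have h4 : m % 4 < 4 := Nat.mod_lt _ (by norm_num)
    obtain ⟨t, ht⟩ : ∃ t, m % 4 = t := ⟨_, rfl⟩
    rw [ht] at hmm h4
    interval_cases t <;> omega
  -- a prime factor with odd exponent
  obtain ⟨p, hpM, hpodd⟩ : ∃ p ∈ (2 ^ ℓ - 1).primeFactors, Odd ((2 ^ ℓ - 1).factorization p) := by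
    by_contra hno
    push Not at hno
    exact hnsq (sparseGoodScales_isSquare_of_even_factorization hM0
      fun p hp => Nat.not_odd_iff_even.mp (hno p hp))
  have hp : p.Prime := Nat.prime_of_mem_primeFactors hpM
  have hpk : p ∣ 2 ^ ℓ - 1 := Nat.dvd_of_mem_primeFactors hpM
  haveI := Fact.mk hp
  have hpq : ¬ p ∣ 2 := not_dvd_base_of_dvd hp hℓ1 (by norm_num) hpk
  have hp2 : p ≠ 2 := fun h2 => hpq (h2 ▸ dvd_refl p)
  have hpl : ¬ p ∣ ℓ := by
    intro hd
    have := (Nat.prime_dvd_prime_iff_eq hp hℓ).mp hd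
    subst this
    exact not_self_dvd_mersenne hp hpk
  -- the exponent of `p` in `2^ℓ − 1` is its level
  have hval : (2 ^ ℓ - 1).factorization p = wieferichLevel 2 p := by
    rw [Nat.factorization_def _ hp, padicValNat_family (le_refl 2) hp hp2 hℓ1 hpk,
      padicValNat.eq_zero_of_not_dvd hpl, add_zero]
  -- `ord_p(2) = ℓ ∣ p − 1`, so `p > ℓ > N`
  have hord : ordMod 2 p = ℓ := by
    have hdvd : ordMod 2 p ∣ ℓ := (dvd_pow_sub_one_iff_ordMod_dvd hp (by norm_num) ℓ).mp hpk
    rcases (Nat.dvd_prime hℓ).mp hdvd with h1 | h1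
    · exfalso
      have : p ∣ 2 ^ 1 - 1 :=
        (dvd_pow_sub_one_iff_ordMod_dvd hp (by norm_num) 1).mpr (h1 ▸ dvd_refl _)
      norm_num at this
      exact hp.one_lt.ne' this
    · exact h1
  have hℓp : ℓ ∣ p - 1 := hord ▸ ordMod_dvd_sub_one hp hpq
  have hpgt : N < p := by
    have := Nat.le_of_dvd (by have := hp.two_le; omega) hℓp
    omega
  exact ⟨p, ⟨hp, hval ▸ hpodd⟩, hpgt⟩

/-- **The rung `L = 2` of the windowed floor at `q = 2`, unconditionally**: infinitely many primes
`p` are non-Wieferich to base `2` or have `2^{p−1} ≡ 1 (mod p^3)` (level `> 2`) — a prime of odd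
level has level `1` (non-Wieferich) or `≥ 3`.  So the windowed floor is informative from `L = 3`
on, and a drought statement with a fixed ratio `Λ ≤ 3/2` (which the method reaches only for
`L < 2Λ ≤ 3`) inherits no open rung: the `∃Λ` residue DA∃ of line `SketchIdeator4` escapes. [folklore] -/
theorem sparseGoodScales_infinite_nonWieferich_or_two_lt_level :
    {p : ℕ | p.Prime ∧ (¬ IsWieferich 2 p ∨ 2 < wieferichLevel 2 p)}.Infinite := by
  refine sparseGoodScales_infinite_odd_wieferichLevel_two.mono ?_
  rintro p ⟨hp, hodd⟩
  refine ⟨hp, ?_⟩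
  have hp2 : p ≠ 2 := by
    rintro rfl
    have h0 : wieferichLevel 2 2 = 0 := by
      unfold wieferichLevel
      exact padicValNat.eq_zero_of_not_dvd (by norm_num)
    rw [h0] at hodd
    exact (Nat.not_odd_iff_even.mpr (by decide)) hodd
  have hpq : ¬ p ∣ 2 := fun hd => hp2 ((Nat.prime_dvd_prime_iff_eq hp Nat.prime_two).mp hd)
  rcases Nat.lt_or_ge (wieferichLevel 2 p) 2 with hlt | hge
  · left
    intro hWf
    have := (isWieferich_iff_two_le_wieferichLevel (le_refl 2) hp hp2 hpq).mp hWf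
    omega
  · right
    obtain ⟨t, ht⟩ := hodd
    omega

end Summit.ABC.ABC.Theorems

end
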